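import Literature.IUT.LogVolume.TensorPacketUnramified
import HarnessLib

/-!
# F″ programme, piece P3: the TRACE DUAL of `𝒪_K` is `𝒪_K` for an UNRAMIFIED `K ⊇ ℚ_p` — in the K-port
# currency of the BSD cell (`--supports stmt-BirchSwinnertonDyer-22226`, helper; route EdixhovenFibreFiveSeven)

HONEST FRAMING. Route `EdixhovenFibreFiveSeven`, crux K★ `StarredOptimalManinUnitFiveSeven`
(stmt-BirchSwinnertonDyer-22226): K★ ⟸ F″ is the tree theorem p581141, and F″ (Kato's zeta-element integrality
in Néron units, `Literature.NumberTheory.EllipticCurves.kato_neron_isIntegral_twistedSymbolSum_of_additive_five_le`,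
cite-only) is the ONE open stub of the registered skeleton `Cruxes/StarredOptimalManinUnitFiveSeven/Lines/kato_lever.lean`.
The F″ programme map (`…/Lines/kato-lever-F2-programme.md`, §4) decomposes F″ ⟸ P1 (cite-only: Kato's values in a
Néron coordinate) ⊕ P2 (receptacle `log_ω(E(K)) = 𝒪_K` over unramified `K`) ⊕ **P3 (trace dual: Tate duality
(S5b) describes `range(exp*_ω)` as the trace dual of `log_ω(E(K))`; once that lattice is `𝒪_K`, the range is
`{a : Tr_{K/ℚ_p}(a·𝒪_K) ⊆ ℤ_p} = 𝒪_K` because `K/ℚ_p` is UNRAMIFIED — different `= (1)`)** ⊕ P4 ⊕ P6.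
THIS FILE closes P3 as a TOOL theorem in the currency of the cell's K-port (`…Theorems.KimAtThreeFineKatoKPort*`:
an abstract complete `K` with `[NormedAlgebra ℚ_[p] K] [IsUltrametricDist K]`, unramifiedness as
`hK : ∀ x, ‖x‖ < 1 → ‖x‖ ≤ ‖p‖`). Nothing here is new mathematics: the different of an absolutely unramified
`p`-adic field is `(1)` is the abc-iut cell's `Literature.IUT.LogVolume.different_eq_top_of_absRamificationIdx_eq_one`
(Serre, *Corps locaux* III §6 Prop. 13 with `e = 1`), and `dual(𝒪_K) = 𝔇⁻¹` is Mathlib's `coeIdeal_differentIdeal`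
(pattern of `Literature.IUT.LogVolume.norm_mul_le_one_of_forall_norm_trace_mul_le_one`, there for `K : Type`
and a generator `δ` of `𝔇`; here universe-polymorphic with `δ = 1`). For the cyclotomic completions
`ℚ(ζ_m)_w`, `p ∤ m`, the same fact is ALREADY the W2 theorem
`…Theorems.KimAtThreeSemiLocalTraceDualLocal.mem_adicCompletionIntegers_iff_forall_trace_mul_mem` (p-generic);
this file is the abstract-`K` form the K-port's receptacle theorems (P2) compose with.
No definition, no named fact, no `sorry`; closes nothing by itself; BSD is not proved by any of this.

## Contents (`𝒪_K = {‖x‖ ≤ 1}`, `Tr = Algebra.trace ℚ_[p] K`)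

* §1 `norm_trace_mul_le_one_of_norm_le_one` — `‖a‖ ≤ 1 ⇒ ‖Tr(a·y)‖ ≤ 1` for all `‖y‖ ≤ 1` (no ramification
  hypothesis: traces of `ℤ_p`-integral elements are in `ℤ_p`).
* §2 `absRamificationIdx_eq_one_of_norm_le_norm_prime` / `norm_le_norm_prime_of_absRamificationIdx_eq_one` —
  the port's hypothesis `hK` IS `e(K/ℚ_p) = 1` (abc-iut cell's `absRamificationIdx`).
* §3 ★ `norm_le_one_of_forall_norm_trace_mul_le_one` (`e = 1`): `Tr(a·𝒪_K) ⊆ ℤ_p ⇒ ‖a‖ ≤ 1`;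
  `norm_le_one_iff_forall_norm_trace_mul_le_one`; the port-currency forms `…_of_unramified`
  (`[CompleteSpace K] [FiniteDimensional ℚ_[p] K]`, hypothesis `hK`).
* §4 the LATTICE form P3 is consumed in: for a set `S ⊆ K` with `S ⊆ 𝒪_K` and `𝒪_K ⊆` the additive closure of
  `S` (P2 delivers `S = log_ω(E(K)) = 𝒪_K`), `{a : ∀ s ∈ S, ‖Tr(a·s)‖ ≤ 1} = 𝒪_K`
  (`norm_le_one_iff_forall_norm_trace_mul_le_one_of_subset_of_le_closure`, `…_of_image_eq`).

References: J.-P. Serre, *Local Fields* (1979), Ch. III §3 Prop. 7, §6 Prop. 13 [SerreLocalFields1979];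
J. Neukirch, *Algebraic Number Theory*, III (2.4)–(2.9) [folklore]; programme map
`Cruxes/StarredOptimalManinUnitFiveSeven/Lines/kato-lever-F2-programme.md` §4 (P3).
-/

noncomputable section

-- the cell's Theorems namespace `Summit.BirchSwinnertonDyer.BirchSwinnertonDyer.…` repeats the summit name by design (D-0017)
set_option linter.dupNamespace false

open scoped NormedField nonZeroDivisors
open Metric Set

namespace Summit.BirchSwinnertonDyer.BirchSwinnertonDyer.Theorems.StarredOptimalManinUnitFiveSevenTraceDual

open Literature.IUT.LogVolume Literature.NumberTheory.GaloisRepresentations.Ultrametric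

variable (p : ℕ) [Fact p.Prime] (K : Type*) [NontriviallyNormedField K] [instK : NormedAlgebra ℚ_[p] K]
  [IsUltrametricDist K]

/-! ## §1 Traces of integral elements are integral (no ramification hypothesis) -/

/-- **`‖a‖ ≤ 1 ⇒ Tr_{K/ℚ_p}(a·y) ∈ ℤ_p` for all `‖y‖ ≤ 1`**: `a·y` is integral over `ℤ_p`
(`norm_le_one_iff_isIntegral`), hence so is its trace, and `ℤ_p` is integrally closed.
[cite: SerreLocalFields1979, Ch. III §3 Prop. 7] -/
theorem norm_trace_mul_le_one_of_norm_le_one [ProperSpace K] {a : K} (ha : ‖a‖ ≤ 1) (y : K) (hy : ‖y‖ ≤ 1) :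
    ‖Algebra.trace ℚ_[p] K (a * y)‖ ≤ 1 := by
  haveI := finiteDimensional p K
  have hay : ‖a * y‖ ≤ 1 := by
    rw [norm_mul]; exact mul_le_one₀ ha (norm_nonneg _) hy
  have hint : IsIntegral ℤ_[p] (Algebra.trace ℚ_[p] K (a * y)) :=
    Algebra.isIntegral_trace ((norm_le_one_iff_isIntegral p K _).mp hay)
  obtain ⟨r, hr⟩ := IsIntegrallyClosed.isIntegral_iff.mp hint
  rw [← hr, PadicInt.algebraMap_apply, PadicInt.padic_norm_e_of_padicInt]
  exact PadicInt.norm_le_one r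

/-! ## §2 The port's unramifiedness hypothesis is `e = 1` -/

/-- **`(∀ x, ‖x‖ < 1 → ‖x‖ ≤ ‖p‖) ⇒ e(K/ℚ_p) = 1`**: a norm uniformizer `ϖ` has `‖ϖ‖ ≤ ‖p‖ = ‖ϖ‖^e`, and
`‖ϖ‖ < 1` forces `e ≤ 1`. [cite: SerreLocalFields1979, Ch. II §1] -/
theorem absRamificationIdx_eq_one_of_norm_le_norm_prime [ProperSpace K]
    (hK : ∀ x : K, ‖x‖ < 1 → ‖x‖ ≤ ‖(p : K)‖) : absRamificationIdx p K = 1 := by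
  obtain ⟨ϖ, hϖ⟩ := exists_isUniformizer (F := K)
  have hpow := norm_prime_eq_norm_pow p K hϖ
  have hle : ‖(ϖ : K)‖ ≤ ‖(ϖ : K)‖ ^ absRamificationIdx p K := hpow ▸ hK _ hϖ.1
  have hpos := absRamificationIdx_pos p K
  have h0 : 0 < ‖(ϖ : K)‖ := norm_units_pos ϖ
  by_contra hne
  have h2 : 2 ≤ absRamificationIdx p K := by omega
  have hlt : ‖(ϖ : K)‖ ^ absRamificationIdx p K < ‖(ϖ : K)‖ := by
    calc ‖(ϖ : K)‖ ^ absRamificationIdx p K ≤ ‖(ϖ : K)‖ ^ 2 :=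
          pow_le_pow_of_le_one h0.le hϖ.1.le h2
      _ < ‖(ϖ : K)‖ := by
          rw [sq]; exact mul_lt_of_lt_one_left h0 hϖ.1
  exact absurd hle (not_le.mpr hlt)

/-- **`e(K/ℚ_p) = 1 ⇒ (∀ x, ‖x‖ < 1 → ‖x‖ ≤ ‖p‖)`** (`‖x‖ ≤ p^{-1/e} = p⁻¹ = ‖p‖`).
[cite: SerreLocalFields1979, Ch. II §1] -/
theorem norm_le_norm_prime_of_absRamificationIdx_eq_one [ProperSpace K] (he : absRamificationIdx p K = 1)
    (x : K) (hx : ‖x‖ < 1) : ‖x‖ ≤ ‖(p : K)‖ := by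
  have h := norm_le_rpow_of_norm_lt_one p K hx
  rw [he, Nat.cast_one, div_one, Real.rpow_neg_one] at h
  rwa [norm_prime p K]

/-! ## §3 The trace dual of `𝒪_K` is `𝒪_K` when `e = 1` -/

/-- **P3, core (`e = 1`): `Tr_{K/ℚ_p}(a·𝒪_K) ⊆ ℤ_p ⇒ ‖a‖ ≤ 1`.** `a` lies in the dual of `𝒪_K`, which is
`𝔇⁻¹` (Mathlib `coeIdeal_differentIdeal`), and `𝔇 = (1)` for an absolutely unramified `K`
(`Literature.IUT.LogVolume.different_eq_top_of_absRamificationIdx_eq_one`).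
[cite: SerreLocalFields1979, Ch. III §3 Prop. 7 and §6 Prop. 13] -/
theorem norm_le_one_of_forall_norm_trace_mul_le_one [ProperSpace K] (he : absRamificationIdx p K = 1)
    {a : K} (h : ∀ y : K, ‖y‖ ≤ 1 → ‖Algebra.trace ℚ_[p] K (a * y)‖ ≤ 1) : ‖a‖ ≤ 1 := by
  classical
  haveI := finiteDimensional p K
  haveI := isFractionRing_integer p K
  have h10 : (1 : FractionalIdeal (Valued.integer K)⁰ K) ≠ 0 := one_ne_zero
  -- `a ∈ dual(𝒪_K)`
  have hmem : a ∈ FractionalIdeal.dual ℤ_[p] ℚ_[p] (1 : FractionalIdeal (Valued.integer K)⁰ K) := by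
    rw [FractionalIdeal.mem_dual h10]
    intro y hy
    obtain ⟨y', rfl⟩ := (FractionalIdeal.mem_one_iff (S := (Valued.integer K)⁰)).mp hy
    refine ⟨⟨Algebra.trace ℚ_[p] K (a * (y' : K)), h _ (Valued.integer.norm_le_one y')⟩, ?_⟩
    rw [Algebra.traceForm_apply, PadicInt.algebraMap_apply]
    rfl
  -- `dual(𝒪_K) = 𝔇⁻¹ = 1`
  have hdual : FractionalIdeal.dual ℤ_[p] ℚ_[p] (1 : FractionalIdeal (Valued.integer K)⁰ K) = 1 := by
    have hD := coeIdeal_differentIdeal ℤ_[p] ℚ_[p] K (Valued.integer K)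
    rw [← different_eq, different_eq_top_of_absRamificationIdx_eq_one p K he, FractionalIdeal.coeIdeal_top]
      at hD
    rw [← inv_inv (FractionalIdeal.dual ℤ_[p] ℚ_[p] _), ← hD, inv_one]
  rw [hdual] at hmem
  obtain ⟨a', ha'⟩ := (FractionalIdeal.mem_one_iff (S := (Valued.integer K)⁰)).mp hmem
  rw [← ha']
  exact Valued.integer.norm_le_one a'

/-- **P3 (`e = 1`), two-sided: `‖a‖ ≤ 1 ↔ Tr_{K/ℚ_p}(a·𝒪_K) ⊆ ℤ_p`** — the trace dual of `𝒪_K` is `𝒪_K`.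
[cite: SerreLocalFields1979, Ch. III §3 Prop. 7 and §6 Prop. 13] -/
theorem norm_le_one_iff_forall_norm_trace_mul_le_one [ProperSpace K] (he : absRamificationIdx p K = 1)
    (a : K) : ‖a‖ ≤ 1 ↔ ∀ y : K, ‖y‖ ≤ 1 → ‖Algebra.trace ℚ_[p] K (a * y)‖ ≤ 1 :=
  ⟨fun ha y hy ↦ norm_trace_mul_le_one_of_norm_le_one p K ha y hy,
    norm_le_one_of_forall_norm_trace_mul_le_one p K he⟩

/-- **P3 in the K-port's currency** (`K` complete and finite-dimensional over `ℚ_p`, unramified as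
`hK : ∀ x, ‖x‖ < 1 → ‖x‖ ≤ ‖p‖`): `Tr_{K/ℚ_p}(a·𝒪_K) ⊆ ℤ_p ⇒ ‖a‖ ≤ 1`.
[cite: SerreLocalFields1979, Ch. III §3 Prop. 7 and §6 Prop. 13] -/
theorem norm_le_one_of_forall_norm_trace_mul_le_one_of_unramified [CompleteSpace K] [FiniteDimensional ℚ_[p] K]
    (hK : ∀ x : K, ‖x‖ < 1 → ‖x‖ ≤ ‖(p : K)‖)
    {a : K} (h : ∀ y : K, ‖y‖ ≤ 1 → ‖Algebra.trace ℚ_[p] K (a * y)‖ ≤ 1) : ‖a‖ ≤ 1 := by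
  haveI : ProperSpace K := FiniteDimensional.proper ℚ_[p] K
  exact norm_le_one_of_forall_norm_trace_mul_le_one p K
    (absRamificationIdx_eq_one_of_norm_le_norm_prime p K hK) h

/-- **P3 in the K-port's currency, two-sided**: `‖a‖ ≤ 1 ↔ Tr_{K/ℚ_p}(a·𝒪_K) ⊆ ℤ_p`.
[cite: SerreLocalFields1979, Ch. III §3 Prop. 7 and §6 Prop. 13] -/
theorem norm_le_one_iff_forall_norm_trace_mul_le_one_of_unramified [CompleteSpace K]
    [FiniteDimensional ℚ_[p] K] (hK : ∀ x : K, ‖x‖ < 1 → ‖x‖ ≤ ‖(p : K)‖) (a : K) :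
    ‖a‖ ≤ 1 ↔ ∀ y : K, ‖y‖ ≤ 1 → ‖Algebra.trace ℚ_[p] K (a * y)‖ ≤ 1 := by
  haveI : ProperSpace K := FiniteDimensional.proper ℚ_[p] K
  exact norm_le_one_iff_forall_norm_trace_mul_le_one p K
    (absRamificationIdx_eq_one_of_norm_le_norm_prime p K hK) a

/-! ## §4 The lattice form: testing the trace against a set whose additive closure contains `𝒪_K` -/

omit [IsUltrametricDist K] in
/-- The condition `‖Tr(a·s)‖ ≤ 1` passes from a set `S` to its additive closure (ultrametric inequality in `ℚ_p`).
[folklore] -/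
theorem forall_norm_trace_mul_le_one_of_mem_closure {a : K} {S : Set K}
    (h : ∀ s ∈ S, ‖Algebra.trace ℚ_[p] K (a * s)‖ ≤ 1) :
    ∀ s ∈ AddSubgroup.closure S, ‖Algebra.trace ℚ_[p] K (a * s)‖ ≤ 1 := by
  intro s hs
  induction hs using AddSubgroup.closure_induction with
  | mem x hx => exact h x hx
  | zero => simp
  | add x y _ _ hx hy =>
      rw [mul_add, map_add]
      exact (IsUltrametricDist.norm_add_le_max _ _).trans (max_le hx hy)
  | neg x _ hx =>
      rw [mul_neg, map_neg, norm_neg]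
      exact hx

/-- **P3, lattice form (`e = 1`).** If `S ⊆ 𝒪_K` and every `y ∈ 𝒪_K` lies in the additive closure of `S`
(e.g. `S = log_ω(E(K)) = 𝒪_K`, piece P2 of the programme), then `{a : ∀ s ∈ S, ‖Tr(a·s)‖ ≤ 1} = 𝒪_K`.
[cite: SerreLocalFields1979, Ch. III §3 Prop. 7 and §6 Prop. 13] -/
theorem norm_le_one_iff_forall_norm_trace_mul_le_one_of_subset_of_le_closure [ProperSpace K]
    (he : absRamificationIdx p K = 1) {S : Set K} (hS₁ : S ⊆ closedBall (0 : K) 1)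
    (hS₂ : closedBall (0 : K) 1 ⊆ (AddSubgroup.closure S : Set K)) (a : K) :
    ‖a‖ ≤ 1 ↔ ∀ s ∈ S, ‖Algebra.trace ℚ_[p] K (a * s)‖ ≤ 1 := by
  constructor
  · intro ha s hs
    exact norm_trace_mul_le_one_of_norm_le_one p K ha s (mem_closedBall_zero_iff.mp (hS₁ hs))
  · intro h
    refine norm_le_one_of_forall_norm_trace_mul_le_one p K he fun y hy ↦ ?_
    exact forall_norm_trace_mul_le_one_of_mem_closure p K h y (hS₂ (mem_closedBall_zero_iff.mpr hy))

/-- **P3, image form, port currency.** If a map `Λ : X → K` (e.g. `Λ = log_ω` on `X = E(K)`) has image EXACTLY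
`𝒪_K = {‖y‖ ≤ 1}` and `K` is unramified (`hK`), then `‖a‖ ≤ 1 ↔ ∀ P, ‖Tr_{K/ℚ_p}(a·Λ P)‖ ≤ 1` — the shape of
the right-hand side of the Tate-duality fact (S5b) `PAdicHodge.exists_smul_range_expStarCoord_iff_trace_log`.
[cite: SerreLocalFields1979, Ch. III §3 Prop. 7 and §6 Prop. 13] -/
theorem norm_le_one_iff_forall_norm_trace_mul_le_one_of_image_eq [CompleteSpace K] [FiniteDimensional ℚ_[p] K]
    (hK : ∀ x : K, ‖x‖ < 1 → ‖x‖ ≤ ‖(p : K)‖) {X : Type*} (Λ : X → K)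
    (hΛ : Set.range Λ = closedBall (0 : K) 1) (a : K) :
    ‖a‖ ≤ 1 ↔ ∀ P : X, ‖Algebra.trace ℚ_[p] K (a * Λ P)‖ ≤ 1 := by
  haveI : ProperSpace K := FiniteDimensional.proper ℚ_[p] K
  have he := absRamificationIdx_eq_one_of_norm_le_norm_prime p K hK
  constructor
  · intro ha P
    have hP : Λ P ∈ closedBall (0 : K) 1 := hΛ ▸ Set.mem_range_self P
    exact norm_trace_mul_le_one_of_norm_le_one p K ha _ (mem_closedBall_zero_iff.mp hP)
  · intro h
    refine norm_le_one_of_forall_norm_trace_mul_le_one p K he fun y hy ↦ ?_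
    obtain ⟨P, rfl⟩ : y ∈ Set.range Λ := hΛ ▸ mem_closedBall_zero_iff.mpr hy
    exact h P

end Summit.BirchSwinnertonDyer.BirchSwinnertonDyer.Theorems.StarredOptimalManinUnitFiveSevenTraceDual

end
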